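import Summits.AtomisticToContinuum.HydrodynamicLimit.Theorems.RelayRaceLocalityNearConstantShortTimeHLTiltL2Defs
import Summits.AtomisticToContinuum.HydrodynamicLimit.Theorems.OneSphereInfluenceStaticScoreResponseCumulantBounds
import Summits.AtomisticToContinuum.HydrodynamicLimit.Theorems.JaynesSqueezeHardSphereLDAConvexity
import Summits.AtomisticToContinuum.HydrodynamicLimit.Theorems.RelayRaceLocalityNearConstantShortTimeHLGeneralFamilyConcentrationContraction
import HarnessLib

/-!
# Crux `NearConstantShortTimeHL` (stmt-AtomisticToContinuum-12502), line `small-tilt-domination`, skeleton v16 —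
# tools for the registered helper `tl_contTilt_of` (the TILTING step of the L² route): registered helper `tlt_exp_moment_le`

Support file (`--supports stmt-AtomisticToContinuum-12502`; file 1 of 2, the assembly is `…TiltL2ContTilt.lean`). The
tilting inequality behind the log-Laplace bound for CONTINUOUS tilts `|G| ≤ 1` of the matched canonical dilute hard-sphere gas
(`ContTiltLogLaplace`, `…TiltL2Defs`), plus the plumbing between `posGibbsMeasure` and the conditioned product law:

* the tilting identity `E_a e^{γ S_G} = Z(a e^{γG})/Z(a)` and Jensen under the tilted law,
  `log Z(a e^{γG}) − log Z(a) ≤ γ E_{a e^{γG}}[S_G] = n γ m(γ)` (`log_posPartition_tilt_ge`), `m(t) := E_{a e^{tG}}[n⁻¹ S_G]`;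
* `m′(t) = n⁻¹ Var_{a e^{tG}}(S_G)` (`hasDerivAt_tilted_mean`) and `VarianceL2` for the tilted profile `profileOf (a e^{tG})`
  (continuous, still dilute: `sup β_t ≤ 2 e^{2γ₁} η₁/σ³`), so `m(γ) ≤ m(0) + γ C₀ ∫ G²` by the mean-value theorem;
* `m(0) = M^G(n)/Ξ(n)` of the matched profile `profileOf (thermoActivity σ ρ₁)` (statics regime, `ρ_lim = ρ₁`, `thermoActivity_spec`),
  which `OnePointUniform` puts within `δ` of `I(G) = ∫ G ρ_lim = ∫ G ρ₁` (`Ilim_eq_integral`), uniformly over the class: the Lipschitz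
  constant of `β = a/∫a` is bounded on the class by the Lipschitz insertion factor (`stub_eosRatioAnalytic`).
References: H.-T. Yau, Lett. Math. Phys. 22 (1991) §2; E. Pulvirenti – D. Tsagkarogiannis, Comm. Math. Phys. 316 (2012) Thm 2.1.
-/

noncomputable section

namespace Summit.AtomisticToContinuum.HydrodynamicLimit.Theorems.NearConstantShortTimeHL

open scoped BigOperators ENNReal
open MeasureTheory Set Filter Topology Finset
open Literature.MathematicalPhysics.KineticTheory Literature.MathematicalPhysics.StatisticalMechanics
open Literature.Probability.LatticeModels
open Summit.AtomisticToContinuum.HydrodynamicLimit.Theorems.KineticWindowGronwallActivityInversion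
open Summit.AtomisticToContinuum.HydrodynamicLimit.Theorems.R2OneModeTwoConditions

/-! ## §1 The insertion-factor package, keeping the Lipschitz constant -/

/-- **The insertion-factor package with its Lipschitz constant** (as `insertionFactor_package`, additionally exporting
`LipschitzOnWith L Rf (Icc 0 r)` from `stub_eosRatioAnalytic`). [folklore] -/
theorem tlt_package :
    ∃ r : ℝ, 0 < r ∧ ∃ Rf : ℝ → ℝ,
      (∀ x ∈ Ioo (-r) r, 0 < Rf x ∧ Rf x * (∑' j : ℕ, bE j / (j.factorial : ℝ) * (x * Rf x) ^ j) = 1) ∧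
      (∀ x ∈ Icc 0 r, 1 ≤ Rf x ∧ Rf x ≤ 2) ∧ ContinuousOn Rf (Icc 0 r) ∧
      (∃ L : NNReal, LipschitzOnWith L Rf (Icc 0 r)) ∧
      (∀ x ∈ Ioo (-r) r, ∀ R ∈ Icc (1 / 2 : ℝ) 2,
        R * (∑' j : ℕ, bE j / (j.factorial : ℝ) * (x * R) ^ j) = 1 → R = Rf x) ∧
      ∃ η₂ : ℝ, 0 < η₂ ∧ η₂ ≤ r ∧ ∀ η ∈ Ioo 0 η₂,
        Real.exp (hsExcessFreeEnergy η + η * deriv hsExcessFreeEnergy η) = Rf η := by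
  obtain ⟨r, hr, Rf, -, -, -, hsol, hbd, hLip, huniq⟩ := stub_eosRatioAnalytic
  obtain ⟨η₁, hη₁, Rf₁, hlog, huniq₁⟩ := excessChemicalPotential_eq_log
  have hcont : ContinuousOn Rf (Icc 0 r) := by
    obtain ⟨L, hL⟩ := hLip
    exact hL.continuousOn
  refine ⟨r, hr, Rf, hsol, hbd, hcont, hLip, huniq, min η₁ r, lt_min hη₁ hr, min_le_right _ _, fun η hη => ?_⟩
  have hη1 : η ∈ Ioo 0 η₁ := ⟨hη.1, hη.2.trans_le (min_le_left _ _)⟩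
  have hηr : η < r := hη.2.trans_le (min_le_right _ _)
  have hηo : η ∈ Ioo (-r) r := ⟨by linarith [hη.1], hηr⟩
  have hηc : η ∈ Icc 0 r := ⟨hη.1.le, hηr.le⟩
  have hroot : Rf η = Rf₁ η :=
    huniq₁ η hη1 (Rf η) ⟨by linarith [(hbd η hηc).1], (hbd η hηc).2⟩ (hsol η hηo).2
  have h := hlog η hη1
  rw [excessChemicalPotential] at h
  rw [h, ← hroot, Real.exp_log (hsol η hηo).1]

/-! ## §2 Expectations under the configurational Gibbs measure through the profile -/

/-- **Integration against `posGibbsMeasure` through the profile**: for a continuous positive activity,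
`∫ F dμ_a = Ξ(n)⁻¹ ∫ F 𝟙[hard core] dμ_P^{⊗n}` (`Z = (∫a)ⁿ Ξ(n)`, `posWeight = (∫a)ⁿ ∏β 𝟙`). [folklore] -/
theorem tlt_integral_posGibbs {a : T3 → ℝ} (ha : Continuous a) (ha0 : ∀ x, 0 < a x) (e : ℝ) (k : ℕ)
    (F : (Fin k → T3) → ℝ) :
    ∫ x, F x ∂posGibbsMeasure a e k =
      (Xi (profileOf a ha ha0) e k k)⁻¹ *
        ∫ x, F x * efR (Ov e) x univ ∂Measure.pi (fun _ : Fin k => (profileOf a ha ha0).μ) := by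
  have hI : 0 < ∫ y, a y := integral_pos_of_continuous_pos ha ha0
  rw [LocalGibbsConcentration.integral_posGibbsMeasure ha (fun y => (ha0 y).le), posPartition_eq ha ha0,
    integral_pi_μ (profileOf a ha ha0) k]
  have hw : ∀ x, posWeight a e k x * F x =
      (∫ y, a y) ^ k * ((∏ i, (profileOf a ha ha0).β (x i)) * (F x * efR (Ov e) x univ)) := by
    intro x
    rw [posWeight_eq ha ha0]
    ring
  simp_rw [hw]
  rw [integral_const_mul, mul_inv]
  have hZk : ((∫ y, a y) ^ k) ≠ 0 := pow_ne_zero k hI.ne'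
  field_simp

/-- **The mean of `n⁻¹ S_g` is the one-point expectation `M^g(n)/Ξ(n)`** (exchangeability). [folklore] -/
theorem tlt_integral_avg_eq {a : T3 → ℝ} (ha : Continuous a) (ha0 : ∀ x, 0 < a x) (e : ℝ) (k : ℕ) [NeZero k]
    {g : T3 → ℝ} (hg : Measurable g) {C : ℝ} (hgC : ∀ y, |g y| ≤ C) :
    ∫ x, ((k : ℝ)⁻¹ * ∑ i, g (x i)) ∂posGibbsMeasure a e k =
      Md (profileOf a ha ha0) e k g k / Xi (profileOf a ha ha0) e k k := by
  rw [tlt_integral_posGibbs ha ha0 e k]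
  have hsum : ∫ x, ((k : ℝ)⁻¹ * ∑ i, g (x i)) * efR (Ov e) x univ ∂Measure.pi (fun _ : Fin k => (profileOf a ha ha0).μ) =
      (k : ℝ)⁻¹ * ∑ i : Fin k, ∫ x, g (x i) * efR (Ov e) x univ ∂Measure.pi (fun _ : Fin k => (profileOf a ha ha0).μ) := by
    have hint : ∀ i : Fin k, Integrable (fun x : Fin k → T3 => g (x i) * efR (Ov e) x univ)
        (Measure.pi fun _ : Fin k => (profileOf a ha ha0).μ) := fun i =>
      integrable_pi_of_bounded (profileOf a ha ha0).μ
        ((hg.comp (measurable_pi_apply i)).mul (measurable_efR (measurableSet_ov e) _))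
        (C := C * 1) fun x => by
          rw [abs_mul]
          exact mul_le_mul (hgC _) (abs_efR_le_one x _) (abs_nonneg _) ((abs_nonneg _).trans (hgC (x i)))
    rw [← integral_finsetSum _ fun i _ => hint i, ← integral_const_mul]
    refine integral_congr_ae (ae_of_all _ fun x => ?_)
    dsimp only
    rw [mul_assoc, Finset.sum_mul]
  rw [hsum]
  simp_rw [integral_mul_efR_eq_Md (profileOf a ha ha0) e hg]
  rw [Finset.sum_const, Finset.card_univ, Fintype.card_fin, nsmul_eq_mul]
  have hk : (k : ℝ) ≠ 0 := Nat.cast_ne_zero.2 (NeZero.ne k)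
  field_simp

/-- **The variance of `S_g` as a conditioned product integral**: with `A = M^g(n)/Ξ(n)`,
`E[(S_g − n A)²] = Ξ(n)⁻¹ ∫ (S_g − nA)² 𝟙[hard core] dμ^{⊗n}`. [folklore] -/
theorem tlt_integral_var_eq {a : T3 → ℝ} (ha : Continuous a) (ha0 : ∀ x, 0 < a x) (e : ℝ) (k : ℕ) [NeZero k]
    (g : T3 → ℝ) :
    ∫ x, (∑ i, g (x i) - (k : ℝ) * (Md (profileOf a ha ha0) e k g k / Xi (profileOf a ha ha0) e k k)) ^ 2
        ∂posGibbsMeasure a e k =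
      (∫ x, (∑ i, g (x i) - (k : ℝ) * (Md (profileOf a ha ha0) e k g k / Xi (profileOf a ha ha0) e k k)) ^ 2 *
          efR (Ov e) x univ ∂Measure.pi (fun _ : Fin k => (profileOf a ha ha0).μ)) /
        Xi (profileOf a ha ha0) e k k := by
  rw [tlt_integral_posGibbs ha ha0 e k]
  exact (div_eq_inv_mul _ _).symm

/-! ## §3 The tilting inequality: `E_b e^{γ S} ≤ exp(n (γ m(0) + γ² D))` from a derivative bound -/

/-- **Covariance of `S` with its own average is the normalised variance**: for a probability measure,
`∫ (n⁻¹S) S − (∫ n⁻¹S)(∫ S) = n⁻¹ ∫ (S − n ∫ n⁻¹S)²`. [folklore] -/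
theorem tlt_cov_eq_var {Ω : Type*} [MeasurableSpace Ω] (μ : Measure Ω) [IsProbabilityMeasure μ] {k : ℕ} [NeZero k]
    {S : Ω → ℝ} (hSm : Measurable S) {K : ℝ} (hSK : ∀ x, |S x| ≤ K) :
    (∫ x, ((k : ℝ)⁻¹ * S x) * S x ∂μ) - (∫ x, (k : ℝ)⁻¹ * S x ∂μ) * (∫ x, S x ∂μ) =
      (k : ℝ)⁻¹ * ∫ x, (S x - (k : ℝ) * ∫ y, (k : ℝ)⁻¹ * S y ∂μ) ^ 2 ∂μ := by
  have hk : (k : ℝ) ≠ 0 := Nat.cast_ne_zero.2 (NeZero.ne k)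
  have hSi : Integrable S μ := (integrable_const K).mono' hSm.aestronglyMeasurable
    (ae_of_all _ fun x => (Real.norm_eq_abs _).le.trans (hSK x))
  have hS2i : Integrable (fun x => S x * S x) μ := by
    refine (integrable_const (K * K)).mono' (hSm.mul hSm).aestronglyMeasurable (ae_of_all _ fun x => ?_)
    rw [Real.norm_eq_abs, abs_mul]
    have hK : 0 ≤ K := (abs_nonneg _).trans (hSK x)
    exact mul_le_mul (hSK x) (hSK x) (abs_nonneg _) hK
  set A : ℝ := ∫ y, (k : ℝ)⁻¹ * S y ∂μ with hA
  have hA' : A = (k : ℝ)⁻¹ * ∫ y, S y ∂μ := by rw [hA, integral_const_mul]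
  have hexp : ∀ x, (S x - (k : ℝ) * A) ^ 2 = (S x * S x - 2 * ((k : ℝ) * A) * S x) + ((k : ℝ) * A) ^ 2 := by
    intro x; ring
  have i0 : Integrable (fun x => 2 * ((k : ℝ) * A) * S x) μ := hSi.const_mul _
  have i1 : Integrable (fun x => S x * S x - 2 * ((k : ℝ) * A) * S x) μ := hS2i.sub i0
  have e1 : ∫ x, (S x - (k : ℝ) * A) ^ 2 ∂μ =
      (∫ x, S x * S x ∂μ) - 2 * ((k : ℝ) * A) * (∫ x, S x ∂μ) + ((k : ℝ) * A) ^ 2 := by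
    simp_rw [hexp]
    rw [integral_add i1 (integrable_const _), integral_sub hS2i i0, integral_const_mul, integral_const,
      probReal_univ, one_smul]
  have h1 : ∫ x, (k : ℝ)⁻¹ * S x * S x ∂μ = (k : ℝ)⁻¹ * ∫ x, S x * S x ∂μ := by
    rw [← integral_const_mul]
    refine integral_congr_ae (ae_of_all _ fun x => ?_)
    ring
  rw [e1, h1, hA']
  field_simp
  ring

/-- **The tilting inequality.** For a continuous positive activity `b`, a continuous tilt `|G| ≤ 1`, `0 < γ ≤ 1/8` and `D`
bounding the derivative `Cov_t(n⁻¹S, S)` of the tilted mean `m(t) = E_{b e^{tG}}[n⁻¹ S]` on `[0, γ]` (all tilted partition functions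
positive): `∫ e^{γ S} dμ_b ≤ exp(n (γ m(0) + γ² D))` (tilt identity, Jensen under the tilted law, mean-value theorem). [cite: Yau1991, §2] -/
theorem tlt_exp_moment_le : ∀ {b G : T3 → ℝ}, Continuous b → (∀ x, 0 < b x) → Continuous G →
    (∀ x, |G x| ≤ 1) → ∀ (e : ℝ) (k : ℕ) [NeZero k] {γ D : ℝ}, 0 < γ → γ ≤ 1 / 8 →
    (∀ t ∈ Icc (0 : ℝ) γ, 0 < posPartition (fun x => b x * Real.exp (t * G x)) e k) →
    (∀ t ∈ Icc (0 : ℝ) γ,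
      (∫ x, ((k : ℝ)⁻¹ * ∑ i, G (x i)) * ∑ i, G (x i) ∂posGibbsMeasure (fun x => b x * Real.exp (t * G x)) e k) -
        (∫ x, (k : ℝ)⁻¹ * ∑ i, G (x i) ∂posGibbsMeasure (fun x => b x * Real.exp (t * G x)) e k) *
          ∫ x, ∑ i, G (x i) ∂posGibbsMeasure (fun x => b x * Real.exp (t * G x)) e k ≤ D) →
    ∫ x, Real.exp (γ * ∑ i, G (x i)) ∂posGibbsMeasure b e k ≤
      Real.exp ((k : ℝ) * (γ * (∫ x, (k : ℝ)⁻¹ * ∑ i, G (x i) ∂posGibbsMeasure b e k) + γ ^ 2 * D)) := by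
  intro b G hb hb0 hGc hG1 e k _ γ D hγ0 hγ hZ hD
  -- notation
  set bt : ℝ → T3 → ℝ := fun t x => b x * Real.exp (t * G x) with hbt
  set F : (Fin k → T3) → ℝ := fun x => (k : ℝ)⁻¹ * ∑ i, G (x i) with hF
  set m : ℝ → ℝ := fun t => ∫ x, F x ∂posGibbsMeasure (bt t) e k with hm
  have hb0' : ∀ x, 0 ≤ b x := fun x => (hb0 x).le
  have hbt0 : ∀ t x, 0 < bt t x := fun t x => mul_pos (hb0 x) (Real.exp_pos _)
  have hbtc : ∀ t, Continuous (bt t) := fun t => LocalGibbsConcentration.continuous_tilt hb hGc t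
  have hb_zero : bt 0 = b := by funext x; simp [hbt]
  have hk : (0 : ℝ) < k := Nat.cast_pos.2 (Nat.pos_of_ne_zero (NeZero.ne k))
  -- measurability and bounds of `F`
  have hSm : Measurable fun x : Fin k → T3 => ∑ i, G (x i) := LocalGibbsConcentration.measurable_sum hGc k
  have hFm : Measurable F := measurable_const.mul hSm
  have hSK : ∀ x : Fin k → T3, |∑ i, G (x i)| ≤ k * 1 := fun x => LocalGibbsConcentration.abs_sum_le hG1 x
  have hFK : ∀ x, |F x| ≤ 1 := by
    intro x
    rw [hF]; dsimp only
    rw [abs_mul, abs_inv, Nat.abs_cast]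
    calc (k : ℝ)⁻¹ * |∑ i, G (x i)| ≤ (k : ℝ)⁻¹ * (k * 1) :=
          mul_le_mul_of_nonneg_left (hSK x) (inv_nonneg.2 hk.le)
      _ = 1 := by field_simp
  -- the derivative of the tilted mean on `[0, γ] ⊂ (-1/4, 1/4)`
  have hquarter : ∀ t ∈ Icc (0 : ℝ) γ, |t| < 1 / 4 := by
    intro t ht
    rw [abs_of_nonneg ht.1]
    linarith [ht.2]
  have hderiv : ∀ t ∈ Icc (0 : ℝ) γ, HasDerivAt m
      ((∫ x, F x * ∑ i, G (x i) ∂posGibbsMeasure (bt t) e k) -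
        (∫ x, F x ∂posGibbsMeasure (bt t) e k) * ∫ x, ∑ i, G (x i) ∂posGibbsMeasure (bt t) e k) t := by
    intro t ht
    exact hasDerivAt_tilted_mean hb hb0 hGc hG1 (hquarter t ht) (hZ t ht) hFm hFK
  -- mean-value theorem: `m γ − m 0 ≤ γ D`
  have hmvt : m γ - m 0 ≤ γ * D := by
    have hcont : ContinuousOn m (Icc 0 γ) := fun t ht => (hderiv t ht).continuousAt.continuousWithinAt
    obtain ⟨c, hc, hc'⟩ := exists_hasDerivAt_eq_slope m _ hγ0 hcont
      (fun t ht => hderiv t ⟨ht.1.le, ht.2.le⟩)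
    have hcI : c ∈ Icc (0 : ℝ) γ := ⟨hc.1.le, hc.2.le⟩
    have hle : (m γ - m 0) / (γ - 0) ≤ D := by rw [← hc']; exact hD c hcI
    rw [sub_zero, div_le_iff₀ hγ0] at hle
    linarith
  -- Jensen under the tilted law: `log Z_γ − log Z_0 ≤ k γ m(γ)`
  obtain ⟨B, hB0, hB⟩ := exists_forall_abs_le_of_continuous hb
  have hγI : γ ∈ Icc (0 : ℝ) γ := ⟨hγ0.le, le_rfl⟩
  have h0I : (0 : ℝ) ∈ Icc (0 : ℝ) γ := ⟨le_rfl, hγ0.le⟩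
  have hZγ := hZ γ hγI
  have hZ0 : 0 < posPartition b e k := by simpa [hb_zero] using hZ 0 h0I
  have hjensen : Real.log (posPartition (bt γ) e k) - Real.log (posPartition b e k) ≤ k * γ * m γ := by
    have hmeas : Measurable (bt γ) := (hbtc γ).measurable
    have hA : ∀ y, bt γ y ≤ B * Real.exp γ := by
      intro y
      have h1 : b y ≤ B := (le_abs_self _).trans (hB y)
      have h2 : Real.exp (γ * G y) ≤ Real.exp γ := by
        refine Real.exp_le_exp.2 ?_
        have := (abs_le.1 (hG1 y)).2
        nlinarith
      exact mul_le_mul h1 h2 (Real.exp_pos _).le hB0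
    have hψ : Measurable fun y => -(γ * G y) := (measurable_const.mul hGc.measurable).neg
    have hψC : ∀ y, |-(γ * G y)| ≤ γ := by
      intro y
      rw [abs_neg, abs_mul, abs_of_pos hγ0]
      exact mul_le_of_le_one_right hγ0.le (hG1 y)
    have hJ := HardSphereLDA.log_posPartition_tilt_ge hmeas (fun y => (hbt0 γ y).le) hA hψ hψC e k hZγ
    have hback : (fun y => bt γ y * Real.exp (-(γ * G y))) = b := by
      funext y
      simp only [hbt]
      rw [mul_assoc, ← Real.exp_add, add_neg_cancel, Real.exp_zero, mul_one]
    rw [hback] at hJ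
    -- the left side of Jensen is `-γ k m(γ)`
    have hlhs : (posPartition (bt γ) e k)⁻¹ * ∫ x, posWeight (bt γ) e k x * ∑ i, -(γ * G (x i)) =
        -(k * γ * m γ) := by
      have hmγ : m γ = (posPartition (bt γ) e k)⁻¹ * ∫ x, posWeight (bt γ) e k x * F x :=
        LocalGibbsConcentration.integral_posGibbsMeasure (hbtc γ) (fun y => (hbt0 γ y).le) e k F
      have hlhs' : ∫ x, posWeight (bt γ) e k x * ∑ i, -(γ * G (x i)) =
          -((k : ℝ) * γ) * ∫ x, posWeight (bt γ) e k x * F x := by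
        rw [← integral_const_mul]
        refine integral_congr_ae (ae_of_all _ fun x => ?_)
        simp only [hF, Finset.sum_neg_distrib, ← Finset.mul_sum]
        field_simp
      rw [hmγ, hlhs']
      ring
    rw [hlhs] at hJ
    linarith
  -- the tilting identity and assembly
  have htilt := LocalGibbsConcentration.integral_exp_mul_sum_posGibbsMeasure hb hb0' G γ e k
  rw [htilt]
  have hratio : (posPartition b e k)⁻¹ * posPartition (bt γ) e k =
      Real.exp (Real.log (posPartition (bt γ) e k) - Real.log (posPartition b e k)) := by
    rw [Real.exp_sub, Real.exp_log hZγ, Real.exp_log hZ0, div_eq_inv_mul]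
  change (posPartition b e k)⁻¹ * posPartition (bt γ) e k ≤ _
  rw [hratio, Real.exp_le_exp]
  have hm0 : m 0 = ∫ x, (k : ℝ)⁻¹ * ∑ i, G (x i) ∂posGibbsMeasure b e k := by
    simp only [hm, hF, hb_zero]
  calc Real.log (posPartition (bt γ) e k) - Real.log (posPartition b e k) ≤ k * γ * m γ := hjensen
    _ ≤ k * γ * (m 0 + γ * D) := by
        have : m γ ≤ m 0 + γ * D := by linarith
        exact mul_le_mul_of_nonneg_left this (by positivity)
    _ = (k : ℝ) * (γ * (∫ x, (k : ℝ)⁻¹ * ∑ i, G (x i) ∂posGibbsMeasure b e k) + γ ^ 2 * D) := by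
        rw [hm0]; ring

/-! ## §4 Profile bounds: the sup of the normalised density, `∫ G² dμ_P`, positivity of `Z`, tilted activities -/

/-- **Sup bound for the profile**: if `a ≤ A` and `I₀ ≤ ∫ a` with `0 < I₀` then `sup β ≤ A/I₀` for `β = a/∫a`. [folklore] -/
theorem tlt_profile_M_le {a : T3 → ℝ} (ha : Continuous a) (ha0 : ∀ x, 0 < a x) {A I₀ : ℝ}
    (hA : ∀ x, a x ≤ A) (hI₀ : 0 < I₀) (hI : I₀ ≤ ∫ y, a y) : (profileOf a ha ha0).M ≤ A / I₀ := by
  have hIa : 0 < ∫ y, a y := integral_pos_of_continuous_pos ha ha0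
  refine csSup_le (Set.range_nonempty _) ?_
  rintro _ ⟨x, rfl⟩
  rw [profileOf_β]
  have hA0 : 0 ≤ A := (ha0 x).le.trans (hA x)
  calc a x / ∫ y, a y ≤ A / ∫ y, a y := div_le_div_of_nonneg_right (hA x) hIa.le
    _ ≤ A / I₀ := div_le_div_of_nonneg_left hA0 hI₀ hI

/-- `∫ G² dμ_P ≤ sup β · ∫ G²` for a bounded measurable `G`. [folklore] -/
theorem tlt_integral_sq_μ_le (P : DensityProfile) {G : T3 → ℝ} (hG : Measurable G) {C : ℝ} (hGC : ∀ x, |G x| ≤ C) :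
    ∫ y, G y ^ 2 ∂P.μ ≤ P.M * ∫ y, G y ^ 2 := by
  rw [P.integral_μ, ← integral_const_mul]
  have hC : 0 ≤ C := (abs_nonneg _).trans (hGC 0)
  have hG2 : ∀ y, G y ^ 2 ≤ C ^ 2 := fun y => by
    rw [← sq_abs]; exact pow_le_pow_left₀ (abs_nonneg _) (hGC y) 2
  have hi1 : Integrable fun y => P.β y * G y ^ 2 := by
    refine (integrable_const (P.M * C ^ 2)).mono' (P.continuous.measurable.mul (hG.pow_const 2)).aestronglyMeasurable
      (ae_of_all _ fun y => ?_)
    rw [Real.norm_eq_abs, abs_mul, abs_of_pos (P.pos y), abs_of_nonneg (sq_nonneg _)]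
    exact mul_le_mul (P.le_M y) (hG2 y) (sq_nonneg _) P.M_pos.le
  have hi2 : Integrable fun y => P.M * G y ^ 2 := by
    refine (integrable_const (P.M * C ^ 2)).mono' (measurable_const.mul (hG.pow_const 2)).aestronglyMeasurable
      (ae_of_all _ fun y => ?_)
    rw [Real.norm_eq_abs, abs_mul, abs_of_pos P.M_pos, abs_of_nonneg (sq_nonneg _)]
    exact mul_le_mul_of_nonneg_left (hG2 y) P.M_pos.le
  exact integral_mono hi1 hi2 fun y => mul_le_mul_of_nonneg_right (P.le_M y) (sq_nonneg _)

/-- **Positivity of the configurational partition function in the dilute regime**: `0 < Z(a)` whenever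
`n p_ε(P) ≤ λ < 1` and `0 ≤ ε < 1/2` (`Z = (∫a)ⁿ Ξ(n)` and the insertion bound). [folklore] -/
theorem tlt_posPartition_pos {a : T3 → ℝ} (ha : Continuous a) (ha0 : ∀ x, 0 < a x) {e lam : ℝ} (he : 0 ≤ e)
    (he2 : e < 1 / 2) {k : ℕ} (hkp : (k : ℝ) * pOv (profileOf a ha ha0) e ≤ lam) (hlam1 : lam < 1) :
    0 < posPartition a e k := by
  rw [posPartition_eq ha ha0]
  exact mul_pos (pow_pos (integral_pos_of_continuous_pos ha ha0) k) (gf_Xi_pos he he2 hkp hlam1 le_rfl)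

/-- **The tilted activity**: for `0 ≤ t ≤ 1/8`, `|G| ≤ 1`, `0 < a ≤ A` and `1 ≤ ∫ a`: `a e^{tG}` is continuous, positive,
`≤ A e^{1/8}`, with `∫ a e^{tG} ≥ e^{-1/8}`, hence `sup β_t ≤ A e^{1/4}`. [folklore] -/
theorem tlt_tilt_profile_M_le {a G : T3 → ℝ} (ha : Continuous a) (ha0 : ∀ x, 0 < a x) (hGc : Continuous G)
    (hG1 : ∀ x, |G x| ≤ 1) {A : ℝ} (hA : ∀ x, a x ≤ A) (hIa : 1 ≤ ∫ y, a y) {t : ℝ} (ht0 : 0 ≤ t) (ht : t ≤ 1 / 8) :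
    (profileOf (fun x => a x * Real.exp (t * G x)) (LocalGibbsConcentration.continuous_tilt ha hGc t)
        (fun x => mul_pos (ha0 x) (Real.exp_pos _))).M ≤ A * Real.exp (1 / 4) := by
  have hA0 : 0 ≤ A := (ha0 0).le.trans (hA 0)
  have hup : ∀ x, a x * Real.exp (t * G x) ≤ A * Real.exp (1 / 8) := by
    intro x
    refine mul_le_mul (hA x) (Real.exp_le_exp.2 ?_) (Real.exp_pos _).le hA0
    have := (abs_le.1 (hG1 x)).2
    nlinarith
  have hlow : Real.exp (-(1 / 8)) ≤ ∫ y, a y * Real.exp (t * G y) := by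
    have hpt : ∀ y, Real.exp (-(1 / 8)) * a y ≤ a y * Real.exp (t * G y) := by
      intro y
      rw [mul_comm]
      refine mul_le_mul_of_nonneg_left (Real.exp_le_exp.2 ?_) (ha0 y).le
      have := (abs_le.1 (hG1 y)).1
      nlinarith
    have hi1 : Integrable fun y => Real.exp (-(1 / 8)) * a y := (integrable_of_continuous_T3 ha).const_mul _
    have hi2 : Integrable fun y => a y * Real.exp (t * G y) :=
      integrable_of_continuous_T3 (LocalGibbsConcentration.continuous_tilt ha hGc t)
    calc Real.exp (-(1 / 8)) ≤ Real.exp (-(1 / 8)) * ∫ y, a y := le_mul_of_one_le_right (Real.exp_pos _).le hIa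
      _ = ∫ y, Real.exp (-(1 / 8)) * a y := (integral_const_mul _ _).symm
      _ ≤ ∫ y, a y * Real.exp (t * G y) := integral_mono hi1 hi2 hpt
  refine (tlt_profile_M_le _ _ hup (Real.exp_pos _) hlow).trans (le_of_eq ?_)
  rw [div_eq_iff (Real.exp_pos _).ne', mul_assoc, ← Real.exp_add]
  norm_num

end Summit.AtomisticToContinuum.HydrodynamicLimit.Theorems.NearConstantShortTimeHL

end
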